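import Mathlib
import HarnessLib
import Summits.ValiantsHypothesis.ValiantsHypothesis.Theorems.SchenstedIndexPowTraceCertificateTools

/-!
# Route SchenstedIndex — block coefficients of polarised polynomials (step (c-alg) of the
# completeness transfer for `BorderPcPerThree`, stmt-ValiantsHypothesis-16085)

`θ : ℂ[x_ℓ : ℓ ∈ L] → ℂ[y_s : s ∈ Fin t × L]`, `x_ℓ ↦ ∑_k y_(k,ℓ)` (slot polarisation; `L = Fin m × Fin m`
in the route).  For a block `B ⊆ Fin t × L` write `1_B = ∑_(s ∈ B) e_s` (square-free exponent) and
`α_B = ∑_(s ∈ B) e_(s.2)` (its LABEL MULTISET).  Then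

* `isWeightedHomogeneous_theta_monomial` — `θ(x^d)` is weighted-homogeneous of weight `d` for the
  label weight `s ↦ e_(s.2)`; hence `coeff_(1_B) θ(x^d) = 0` unless `d = α_B`
  (`coeff_indicator_theta_monomial_eq_zero`);
* **`coeff_indicator_theta`** — for EVERY polynomial `f`:
  `coeff_(1_B) (θ f) = μ_B · coeff_(α_B) f` with the universal constant `μ_B := coeff_(1_B) θ(x^(α_B))`;
* `coeff_indicator_theta_monomial_self_ne_zero` — `μ_B ≠ 0` when `|B| = m` (it counts the bijections
  `Fin m ≃ B` compatible with a fixed labelling; `coeff_indicator_prod_linearForms`).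

So the block functional `E(θ f)(π) = ∏_(B ∈ π) coeff_(1_B)(θ f)` equals `(∏_B μ_B) · ∏_B coeff_(α_B) f` — a
nonzero multiple of a MONOMIAL in the coefficients of `f` determined by the label multisets of the blocks
(the bridge between polynomials on coefficient space and functionals on block partitions).
Route-independent file.  HONEST FRAMING: bookkeeping for an OPEN support item; nothing on `VP ≠ VNP`.
-/

set_option linter.dupNamespace false

noncomputable section

namespace Summit.ValiantsHypothesis.ValiantsHypothesis.Theorems.SchenstedIndex

open MvPolynomial
open Literature.Computability.AlgebraicComplexity

/-- `θ(x^d)` is weighted-homogeneous of weight `d` for the label weight `s ↦ e_(s.2)`. -/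
theorem isWeightedHomogeneous_theta_monomial {t : ℕ} {L : Type*} [DecidableEq L]
    (d : L →₀ ℕ) (c : ℂ) :
    IsWeightedHomogeneous (fun s : Fin t × L => (Finsupp.single s.2 1 : L →₀ ℕ))
      (aeval (fun ℓ : L => ∑ k : Fin t, (X (k, ℓ) : MvPolynomial (Fin t × L) ℂ)) (monomial d c)) d := by
  classical
  rw [aeval_monomial, Finsupp.prod]
  have hX : ∀ ℓ : L, IsWeightedHomogeneous (fun s : Fin t × L => (Finsupp.single s.2 1 : L →₀ ℕ))
      (∑ k : Fin t, (X (k, ℓ) : MvPolynomial (Fin t × L) ℂ)) (Finsupp.single ℓ 1) := fun ℓ =>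
    IsWeightedHomogeneous.sum _ _ _ fun k _ => isWeightedHomogeneous_X ℂ _ (k, ℓ)
  have hprod : IsWeightedHomogeneous (fun s : Fin t × L => (Finsupp.single s.2 1 : L →₀ ℕ))
      (∏ ℓ ∈ d.support, (∑ k : Fin t, (X (k, ℓ) : MvPolynomial (Fin t × L) ℂ)) ^ d ℓ)
      (∑ ℓ ∈ d.support, d ℓ • Finsupp.single ℓ 1) :=
    IsWeightedHomogeneous.prod _ _ _ fun ℓ _ => (hX ℓ).pow _
  have hd : (∑ ℓ ∈ d.support, d ℓ • Finsupp.single ℓ 1 : L →₀ ℕ) = d := by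
    conv_rhs => rw [← Finsupp.sum_single d]
    rw [Finsupp.sum]
    refine Finset.sum_congr rfl fun ℓ _ => ?_
    rw [Finsupp.smul_single, smul_eq_mul, mul_one]
  rw [hd] at hprod
  rw [algebraMap_eq]
  have h := (isWeightedHomogeneous_C (fun s : Fin t × L => (Finsupp.single s.2 1 : L →₀ ℕ)) c).mul hprod
  rwa [zero_add] at h

/-- The label weight of the square-free exponent of a block is its label multiset:
`weight (1_B) = α_B`. -/
theorem weight_indicator_eq_labelMultiset {t : ℕ} {L : Type*} [DecidableEq L]
    (B : Finset (Fin t × L)) :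
    Finsupp.weight (fun s : Fin t × L => (Finsupp.single s.2 1 : L →₀ ℕ))
        (∑ s ∈ B, Finsupp.single s 1) = ∑ s ∈ B, Finsupp.single s.2 1 := by
  classical
  rw [map_sum]
  refine Finset.sum_congr rfl fun s _ => ?_
  rw [Finsupp.weight_apply, Finsupp.sum_single_index (by simp)]
  simp

/-- `coeff_(1_B) θ(x^d) = 0` unless `d` is the label multiset `α_B` of the block. -/
theorem coeff_indicator_theta_monomial_eq_zero {t : ℕ} {L : Type*} [DecidableEq L]
    (B : Finset (Fin t × L)) (d : L →₀ ℕ) (c : ℂ) (h : (∑ s ∈ B, Finsupp.single s.2 1) ≠ d) :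
    coeff (∑ s ∈ B, Finsupp.single s 1)
      (aeval (fun ℓ : L => ∑ k : Fin t, (X (k, ℓ) : MvPolynomial (Fin t × L) ℂ)) (monomial d c)) = 0 := by
  classical
  refine (isWeightedHomogeneous_theta_monomial d c).coeff_eq_zero _ ?_
  rw [weight_indicator_eq_labelMultiset]
  exact h

/-- **Block coefficients of `θ f` read one coefficient of `f`**: for every polynomial `f`,
`coeff_(1_B) (θ f) = μ_B · coeff_(α_B) f` with the universal constant `μ_B = coeff_(1_B) θ(x^(α_B))`. -/
theorem coeff_indicator_theta {t : ℕ} {L : Type*} [Fintype L] [DecidableEq L]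
    (B : Finset (Fin t × L)) (f : MvPolynomial L ℂ) :
    coeff (∑ s ∈ B, Finsupp.single s 1)
        (aeval (fun ℓ : L => ∑ k : Fin t, (X (k, ℓ) : MvPolynomial (Fin t × L) ℂ)) f) =
      coeff (∑ s ∈ B, Finsupp.single s 1)
          (aeval (fun ℓ : L => ∑ k : Fin t, (X (k, ℓ) : MvPolynomial (Fin t × L) ℂ))
            (monomial (∑ s ∈ B, Finsupp.single s.2 1) (1 : ℂ))) *
        coeff (∑ s ∈ B, Finsupp.single s.2 1) f := by
  classical
  set θ : MvPolynomial L ℂ →ₐ[ℂ] MvPolynomial (Fin t × L) ℂ :=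
    aeval (fun ℓ : L => ∑ k : Fin t, (X (k, ℓ) : MvPolynomial (Fin t × L) ℂ)) with hθ
  set α : L →₀ ℕ := ∑ s ∈ B, Finsupp.single s.2 1 with hα
  have hf : θ f = ∑ d ∈ f.support, θ (monomial d (coeff d f)) := by
    conv_lhs => rw [f.as_sum]
    exact map_sum θ (fun d => monomial d (coeff d f)) f.support
  rw [hf, coeff_sum, Finset.sum_eq_single α]
  · -- the term `d = α`
    rw [show monomial α (coeff α f) = C (coeff α f) * monomial α (1 : ℂ) by
        rw [C_mul_monomial, mul_one], map_mul, hθ, aeval_C, algebraMap_eq, coeff_C_mul, mul_comm]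
  · intro d _ hd
    exact coeff_indicator_theta_monomial_eq_zero B d _ (Ne.symm hd)
  · intro hα'
    rw [MvPolynomial.notMem_support_iff.1 hα', monomial_zero, map_zero, coeff_zero]

/-- A product of variables indexed by the block, read through the labels, is the monomial of the
label multiset: `∏_(s ∈ B) x_(s.2) = x^(α_B)`. -/
theorem prod_X_snd_eq_monomial {t : ℕ} {L : Type*} [DecidableEq L] (B : Finset (Fin t × L)) :
    (∏ s ∈ B, (X s.2 : MvPolynomial L ℂ)) = monomial (∑ s ∈ B, Finsupp.single s.2 1) 1 := by
  rw [monomial_sum_one]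
  rfl

/-- **`μ_B ≠ 0`**: the square-free block coefficient of `θ(x^(α_B))` is a positive count (the
bijections `Fin m ≃ B` compatible with a fixed labelling of `B`), for `|B| = m`. -/
theorem coeff_indicator_theta_monomial_self_ne_zero {t m : ℕ} {L : Type*} [Fintype L]
    [DecidableEq L] (B : Finset (Fin t × L)) (hB : B.card = m) :
    coeff (∑ s ∈ B, Finsupp.single s 1)
      (aeval (fun ℓ : L => ∑ k : Fin t, (X (k, ℓ) : MvPolynomial (Fin t × L) ℂ))
        (monomial (∑ s ∈ B, Finsupp.single s.2 1) (1 : ℂ))) ≠ 0 := by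
  -- enumerate the block
  let u : Fin m ≃ ↥B := (Finset.equivFinOfCardEq hB).symm
  -- `θ(x^(α_B)) = ∏_i ∑_s [s.2 = (u i).2] y_s`
  have hprod : aeval (fun ℓ : L => ∑ k : Fin t, (X (k, ℓ) : MvPolynomial (Fin t × L) ℂ))
      (monomial (∑ s ∈ B, Finsupp.single s.2 1) (1 : ℂ)) =
      ∏ i : Fin m, ∑ s : Fin t × L,
        C (if s.2 = ((u i : ↥B) : Fin t × L).2 then (1 : ℂ) else 0) * X s := by
    rw [← prod_X_snd_eq_monomial, map_prod]
    rw [← Finset.prod_coe_sort B, ← u.prod_comp]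
    refine Finset.prod_congr rfl fun i _ => ?_
    rw [aeval_X, Fintype.sum_prod_type]
    refine Finset.sum_congr rfl fun k _ => ?_
    simp_rw [apply_ite C, map_one, map_zero, ite_mul, one_mul, zero_mul]
    rw [Finset.sum_ite_eq']
    simp
  rw [hprod, coeff_indicator_prod_linearForms B hB]
  -- the sum of 0/1 terms contains the term `q = u`
  simp_rw [Finset.prod_boole]
  suffices hne : (∑ q : Fin m ≃ ↥B, if (∀ i ∈ (Finset.univ : Finset (Fin m)),
      ((q i : ↥B) : Fin t × L).2 = ((u i : ↥B) : Fin t × L).2) then (1 : ℂ) else 0) ≠ 0 by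
    convert hne using 3
  have hsum : (∑ q : Fin m ≃ ↥B, if (∀ i ∈ (Finset.univ : Finset (Fin m)),
      ((q i : ↥B) : Fin t × L).2 = ((u i : ↥B) : Fin t × L).2) then (1 : ℂ) else 0) =
      ((Finset.univ.filter (fun q : Fin m ≃ ↥B => ∀ i ∈ (Finset.univ : Finset (Fin m)),
        ((q i : ↥B) : Fin t × L).2 = ((u i : ↥B) : Fin t × L).2)).card : ℂ) := by
    rw [Finset.natCast_card_filter]
  rw [hsum, Nat.cast_ne_zero]
  exact Finset.card_ne_zero.2 ⟨u, Finset.mem_filter.2 ⟨Finset.mem_univ _, fun i _ => rfl⟩⟩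

end Summit.ValiantsHypothesis.ValiantsHypothesis.Theorems.SchenstedIndex

end
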